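import Mathlib
import Summits.ResolutionOfSingularities.ResolutionOfSingularities.Theorems.SyzygyFlatteningDefs
import HarnessLib

/-!
# Syzygy-flattening tower: termination along valuations with at most two overrings

Stub `stub_rankLeOneDimZero` of the crux `HigherRankTermination` (line `birth`): assuming
`RankOneInput p` (termination along every rank-one, dimension-zero valuation), the tower
terminates along every dimension-zero valuation ring `O` of `K` whose only overrings are `O`
and `K` (`TwoOverrings O`).

* If `O = ⊤ = K` (the trivial valuation), stage `0` of the tower is `locAt ⊤ A = K`
  (every element of `K = Frac A` is a fraction `a * s⁻¹`, `a, s ∈ A`), a field, hence a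
  regular local ring.
* If `O ≠ ⊤`, the two overrings `O, ⊤` correspond under
  `ValuationSubring.primeSpectrumEquiv` to the two primes `𝔪_O ≠ ⊥` of `O`, so
  `ringKrullDim O = 1` and `RankOneInput p` applies verbatim.
-/

noncomputable section

set_option linter.dupNamespace false

namespace Summit.ResolutionOfSingularities.ResolutionOfSingularities.Theorems.SyzygyFlattening

open Summit.ResolutionOfSingularities.ResolutionOfSingularities.Theses.SyzygyFlattening

variable {k K : Type} [Field k] [Field K] [Algebra k K]

/-! ## Rank at most one and not trivial: Krull dimension one -/

/-- Two primes of a valuation subring with the same coarsening are equal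
(`ValuationSubring.primeSpectrumEquiv` is injective). [folklore] -/
theorem rankLeOne_primeSpectrum_eq_of_ofPrime_eq (O : ValuationSubring K)
    (P Q : PrimeSpectrum ↥O) (h : O.ofPrime P.asIdeal = O.ofPrime Q.asIdeal) : P = Q := by
  apply O.primeSpectrumEquiv.injective
  ext1
  simpa [ValuationSubring.primeSpectrumEquiv_apply] using h

/-- A valuation subring `O ≠ ⊤` is not a field: its maximal ideal is non-zero (the prime `⊥`
corresponds to the overring `⊤ ≠ O`). [folklore] -/
theorem rankLeOne_maximalIdeal_ne_bot (O : ValuationSubring K) (hO : O ≠ ⊤) :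
    IsLocalRing.maximalIdeal ↥O ≠ ⊥ := by
  intro h
  apply hO
  have key := rankLeOne_primeSpectrum_eq_of_ofPrime_eq O
  have h1 : O.ofPrime (IsLocalRing.maximalIdeal ↥O) = O := ValuationSubring.ofPrime_top O
  have h2 : O.ofPrime (⊥ : Ideal ↥O) = ⊤ := ValuationSubring.ofPrime_bot O
  -- the closed point and the generic point of `Spec O` coincide
  have hpt : (⟨IsLocalRing.maximalIdeal ↥O, inferInstance⟩ : PrimeSpectrum ↥O) =
      ⟨⊥, Ideal.isPrime_bot⟩ := PrimeSpectrum.ext h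
  have := congrArg (fun P : PrimeSpectrum ↥O => O.ofPrime P.asIdeal) hpt
  simp only at this
  rw [h1, h2] at this
  exact this

/-- A valuation subring `O ≠ ⊤` is not a field. [folklore] -/
theorem rankLeOne_not_isField (O : ValuationSubring K) (hO : O ≠ ⊤) : ¬ IsField ↥O :=
  fun hF => rankLeOne_maximalIdeal_ne_bot O hO (IsLocalRing.isField_iff_maximalIdeal_eq.mp hF)

/-- If the only overrings of `O` are `O` and `⊤`, then `O` has Krull dimension at most one:
every non-zero prime is maximal. [cite: ZariskiSamuel1960, VI §10] -/
theorem rankLeOne_krullDimLE_one (O : ValuationSubring K) (h2 : TwoOverrings O) :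
    Ring.KrullDimLE 1 ↥O := by
  refine Ring.KrullDimLE.mk₁' fun I hI hIp => ?_
  rcases h2 (O.ofPrime I) (O.le_ofPrime I) with h | h
  · -- `ofPrime O I = O = ofPrime O 𝔪`, so `I = 𝔪`
    have hPQ := rankLeOne_primeSpectrum_eq_of_ofPrime_eq O ⟨I, hIp⟩
      ⟨IsLocalRing.maximalIdeal ↥O, inferInstance⟩ (by rw [ValuationSubring.ofPrime_top]; exact h)
    have hI' : I = IsLocalRing.maximalIdeal ↥O := congrArg PrimeSpectrum.asIdeal hPQ
    rw [hI']
    exact IsLocalRing.maximalIdeal.isMaximal ↥O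
  · -- `ofPrime O I = ⊤ = ofPrime O ⊥`, so `I = ⊥`, excluded
    have hPQ := rankLeOne_primeSpectrum_eq_of_ofPrime_eq O ⟨I, hIp⟩ ⟨⊥, Ideal.isPrime_bot⟩
      (by rw [ValuationSubring.ofPrime_bot]; exact h)
    exact absurd (congrArg PrimeSpectrum.asIdeal hPQ) hI

/-- **Rank one**: a valuation subring `O ≠ ⊤` whose only overrings are `O` and `⊤` has Krull
dimension exactly one. [cite: ZariskiSamuel1960, VI §10] -/
theorem rankLeOne_ringKrullDim_eq_one (O : ValuationSubring K) (hO : O ≠ ⊤)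
    (h2 : TwoOverrings O) : ringKrullDim ↥O = 1 := by
  have h1 := rankLeOne_krullDimLE_one O h2
  apply eq_of_le_of_not_lt ?_ fun h' ↦ rankLeOne_not_isField O hO ?_
  · rw [← Nat.cast_one, ← Ring.krullDimLE_iff]
    exact h1
  · have h'' : ringKrullDim ↥O ≤ 0 := Order.le_of_lt_succ h'
    rw [← Nat.cast_zero, ← Ring.krullDimLE_iff] at h''
    exact Ring.KrullDimLE.isField_of_isDomain

/-! ## The trivial valuation: stage `0` is the field `K` -/

/-- Along the trivial valuation `⊤ = K`, localising `A` with `Frac A = K` at the centre gives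
all of `K`: `locAt ⊤ A = ⊤`. [folklore] -/
theorem locAt_top_eq_top (A : Subalgebra k K) [IsFractionRing ↥A K] :
    locAt (⊤ : ValuationSubring K) A = ⊤ := by
  refine eq_top_iff.mpr fun y _ => ?_
  obtain ⟨a, s, -, hy⟩ := IsFractionRing.div_surjective (A := ↥A) y
  refine Algebra.subset_adjoin ⟨a, a.2, s, s.2, ValuationSubring.mem_top _, ?_⟩
  rw [← hy, div_eq_mul_inv]
  rfl

/-- Along the trivial valuation the tower terminates at stage `0`: `tower ⊤ A 0 = locAt ⊤ A = K`
is a field, hence a regular local ring. [folklore] -/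
theorem towerTerminates_top (A : Subalgebra k K) [IsFractionRing ↥A K] :
    TowerTerminates (⊤ : ValuationSubring K) A := by
  refine ⟨0, ?_⟩
  have e : ↥(tower (⊤ : ValuationSubring K) A 0) ≃ₐ[k] K :=
    (Subalgebra.equivOfEq _ _ ((tower_zero _ A).trans (locAt_top_eq_top A))).trans
      Subalgebra.topEquiv
  exact IsRegularLocalRing.of_ringEquiv e.symm.toRingEquiv

/-! ## The stub -/

/-- **STUB `stub_rankLeOneDimZero`.** From `RankOneTermination` at `p`, the tower
terminates along every DIMENSION-ZERO valuation ring with at most the two overrings `O, K`: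
either `O = K` (then `tower O A 0 = locAt ⊤ A = Frac A = K` as a `k`-subalgebra, a field, hence
a regular local ring), or `O ≠ K` and two overrings force `ringKrullDim O = 1`
(`ValuationSubring.primeSpectrumEquiv`), where `RankOneInput p` is the claim verbatim.
[cite: ZariskiSamuel1960, VI §10] -/
theorem stub_rankLeOneDimZero : ∀ (p : ℕ), p.Prime → RankOneInput p →
    ∀ (k K : Type) [Field k] [CharP k p] [Field K] [Algebra k K] (O : ValuationSubring K)
      (A : Subalgebra k K), (∀ c : k, algebraMap k K c ∈ O) → A.FG → IsFractionRing ↥A K →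
      A.toSubring ≤ O.toSubring → DimZero k O → TwoOverrings O → TowerTerminates O A := by
  intro p _ hR1 k K _ _ _ _ O A hk hFG hFrac hAO hdim h2
  by_cases hO : O = ⊤
  · subst hO
    exact towerTerminates_top A
  · exact hR1 k K O A hk hFG hFrac hAO hdim (rankLeOne_ringKrullDim_eq_one O hO h2)

end Summit.ResolutionOfSingularities.ResolutionOfSingularities.Theorems.SyzygyFlattening

end
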